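import Summits.QuantumFields.YangMills.Theses.RecentredCoverTransfer
import Summits.QuantumFields.YangMills.Theorems.RecentredCoverTransferNearDiagonalVanishingCount
import HarnessLib

/-!
# Route `RecentredCoverTransfer` (LINE g9-B′, planner ym-idea-1 g9), crux `NearDiagonalVanishing` (stmt-QuantumFields-23257) —
# II: the TORUS HALF, and the reduction of the item to its cover half

`NearDiagonalVanishing` (UV half of LINE g9-B′) asks, for `n ≥ 2` and `F ∈ ⁰𝒮` with compact support, that for every `ε` some
`δ > 0` makes the near-diagonal parts (a pair at physical sup-distance `< δ`) of BOTH centred moment sums `≤ ε` eventually along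
the leg scheme: on the checkerboard cover and on the straight torus.  Critic idea-crit-4 (verdict on LINE g9-B′, 2026-08-28):
«torus half provable now (MomentBounds6), cover half ≤ 23143 `CoverMomentBounds6`».  This file proves the torus half and reduces
the item to the cover half:

* §1 `torus_near_sum_le` — at ONE lattice in the regime `0 < a ≤ min(1, ℓ₄, δ)`, `L ≥ 14`, `L ≥ a⁻²`, `β ≥ β₄`: the torus
  near-diagonal sum is `≤ K₀ⁿ·S(F)·n²·(2K_F+1)^{4(n−1)}·(3δ)⁴`.  No new analysis: the tree's E0′ toolkit VI-c
  `OSLegsFromFemtoAndGap.pointwise_bound` (wrap / near-diagonal / separated regimes; the infinite-order vanishing of `⁰𝒮` at the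
  coincidence locus is built in) gives `|W(x)|·‖F(a x)‖ ≤ K₀ⁿ a^{4n} S(F)` at EVERY multi-site, and part I
  (`NearDiagonal.near_sum_le`) counts the near tuples inside the support;
* §2 ★ `torus_nearDiagonal_eventually` — the torus clause of `NearDiagonalVanishing` verbatim under its binders
  (`MomentBounds6 ⇒ MomentBounds`, `IsLegScheme`: `a_k = a(β_k) → 0`, `β_k → ∞`, `a_k ≤ 1/24`, `L_k ≥ 14`, `L_k ≥ a_k⁻²`);
* §3 ★ `nearDiagonalVanishing_of_coverHalf` — the COVER clause (stated inline, = what 23143 `CoverMomentBounds6` must deliver)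
  implies `Theses.RecentredCoverTransfer.NearDiagonalVanishing` BY NAME (`δ := min δ_C δ_T`, monotonicity in `δ`).

Width seat ym-line-sfw-p2-w2 g23 (cell ym-idea-1; free hands), `--supports stmt-QuantumFields-23257`.  THEOREMS ONLY.  HONEST FRAMING:
the cover half (cell-uniform single-scale ceilings on the D₄ cover, 23143) stays OPEN, so 23257 is NOT closed by this file; no crux,
no rung (R2d ROT is a RECORD rung) and no summit is proved; the Yang–Mills mass gap is NOT proved by any of this.
-/

set_option autoImplicit false

noncomputable section

open scoped SchwartzMap BigOperators
open MeasureTheory Filter Topology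
open Literature.MathematicalPhysics.QuantumFieldTheory Literature.MathematicalPhysics.QuantumLattice
open Literature.MathematicalPhysics.AQFT
open Literature.Probability.LatticeModels (Site box mem_box)
open Summit.QuantumFields.YangMills.Theorems.OSLegsFromFemtoAndGap (torusMoment pointwise_bound
  abs_torusMoment_le_of_momentBounds momentBounds_of_momentBounds6 mul_norm_le_norm_smul_siteToE)
open Summit.QuantumFields.YangMills.Cruxes.OSLegsFromFemtoAndGap.DlrCollarTransfer (MomentBounds MomentBounds6)
open Summit.QuantumFields.YangMills.Theorems.ROT (IsLegScheme PeriodCell)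

namespace Summit.QuantumFields.YangMills.Theorems.RecentredCoverTransfer.NearDiagonal

local notation "E4" => EuclideanSpace ℝ (Fin 4)

variable {G : Type} [Group G] [TopologicalSpace G] [IsTopologicalGroup G] [CompactSpace G]
  [MeasurableSpace G] [BorelSpace G]

/-! ## §1 The torus near-diagonal sum at one lattice -/

/-- **Torus near-diagonal sum at one lattice.**  In the regime of the E0′ toolkit (`0 < a ≤ min 1 ℓ₄`, `L ≥ 14`, `L ≥ a⁻²`, the
unpacked `MomentBounds` estimate `H` at `β`), for `n ≥ 2`, `F ∈ ⁰𝒮` supported in the closed ball of radius `K`, and `a ≤ δ`: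
the near-diagonal part of `Σ_{x ∈ box(L)ⁿ} |W(x)|·‖F(a x)‖` is `≤ K₀ⁿ·S(F)·n²·(2K+1)^{4(n−1)}·(3δ)⁴`, `K₀, S(F)` the constant and
seminorm budget of `OSLegsFromFemtoAndGap.pointwise_bound`. [folklore] -/
theorem torus_near_sum_le (r : LatticeRep G) {C ℓ₄ C₀ a β δ K : ℝ} {L n : ℕ} (hℓ : 0 < ℓ₄) (hC : 0 ≤ C)
    (hC₀ : ∀ U, |r.curvature.F U| ≤ C₀)
    (H : ∀ (x : Fin n → Site 4) (R : ℕ), 1 ≤ R → (R : ℝ) * a ≤ ℓ₄ → 4 * R + 8 ≤ L →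
      (∀ i j : Fin n, i ≠ j → ∃ k : Fin 4,
        (2 * (R : ℤ) + 4) ≤ |((((x i k - x j k : ℤ) : ZMod (2 * L + 1))).valMinAbs : ℤ)|) →
      |torusMoment r.ρ β L r.curvature.F (wilsonTorusMean r.ρ β L r.curvature.F) x| ≤ (C / (R : ℝ) ^ 4) ^ n)
    (ha : 0 < a) (ha1 : a ≤ 1) (haℓ : a ≤ ℓ₄) (haδ : a ≤ δ) (hL14 : 14 ≤ L) (hLa : a⁻¹ * a⁻¹ ≤ L)
    (hn : 2 ≤ n) (F : 𝓢((Fin n → E4), ℂ)) (hF : IsOffDiagonal F) (hK : 0 ≤ K)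
    (hFK : tsupport (F : (Fin n → E4) → ℂ) ⊆ Metric.closedBall 0 K) :
    ∑ x ∈ Fintype.piFinset (fun _ : Fin n => box 4 L),
        (if (∃ i j : Fin n, i ≠ j ∧ ∀ l : Fin 4, a * |((x i l - x j l : ℤ) : ℝ)| < δ) then
          |torusMoment r.ρ β L r.curvature.F (wilsonTorusMean r.ρ β L r.curvature.F) x| *
            ‖F (fun i => a • siteToE (x i))‖ else 0) ≤
      ((C₀ + C₀) * 2 ^ 4 * 3 ^ 6 + (C₀ + C₀) * 2 ^ 6 * 10 ^ 4 + 16 * C * 2 ^ 6 * (2 / ℓ₄ + 24) ^ 4) ^ n *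
          (SchwartzMap.seminorm ℂ 0 (4 * n) F + SchwartzMap.seminorm ℂ (6 * n) (4 * n) F +
            SchwartzMap.seminorm ℂ 0 0 F + SchwartzMap.seminorm ℂ (6 * n) 0 F +
            SchwartzMap.seminorm ℂ (10 * n) 0 F) *
        ((n : ℝ) ^ 2 * (2 * K + 1) ^ (4 * (n - 1)) * (3 * δ) ^ 4) := by
  have hC₀0 : 0 ≤ C₀ := le_trans (abs_nonneg _) (hC₀ (fun _ => 1))
  set Kpt : ℝ := (C₀ + C₀) * 2 ^ 4 * 3 ^ 6 + (C₀ + C₀) * 2 ^ 6 * 10 ^ 4 + 16 * C * 2 ^ 6 * (2 / ℓ₄ + 24) ^ 4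
    with hKpt
  set Ssum : ℝ := SchwartzMap.seminorm ℂ 0 (4 * n) F + SchwartzMap.seminorm ℂ (6 * n) (4 * n) F +
    SchwartzMap.seminorm ℂ 0 0 F + SchwartzMap.seminorm ℂ (6 * n) 0 F + SchwartzMap.seminorm ℂ (10 * n) 0 F
    with hSsum
  have hKpt0 : 0 ≤ Kpt := by rw [hKpt]; positivity
  have hSsum0 : 0 ≤ Ssum := by rw [hSsum]; positivity
  refine near_sum_le hn
    (fun x => torusMoment r.ρ β L r.curvature.F (wilsonTorusMean r.ρ β L r.curvature.F) x)
    (fun x => ‖F (fun i => a • siteToE (x i))‖) (fun x => norm_nonneg _) ha ha1 haδ hK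
    (mul_nonneg (pow_nonneg hKpt0 n) hSsum0) ?_ ?_ L
  · -- the dimension-4 pointwise bound from toolkit VI-c (drop the weight `(1 + ‖a x‖)^{6n} ≥ 1`)
    intro x
    have h := pointwise_bound r hℓ hC hC₀ H ha ha1 haℓ hL14 hLa hn F hF x
    have h1 : 1 ≤ (1 + ‖(fun i => a • siteToE (x i))‖) ^ (6 * n) :=
      one_le_pow₀ (by linarith [norm_nonneg (fun i => a • siteToE (x i))])
    have h0 : 0 ≤ |torusMoment r.ρ β L r.curvature.F (wilsonTorusMean r.ρ β L r.curvature.F) x| *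
        ‖F (fun i => a • siteToE (x i))‖ := mul_nonneg (abs_nonneg _) (norm_nonneg _)
    calc |torusMoment r.ρ β L r.curvature.F (wilsonTorusMean r.ρ β L r.curvature.F) x| *
          ‖F (fun i => a • siteToE (x i))‖
        ≤ |torusMoment r.ρ β L r.curvature.F (wilsonTorusMean r.ρ β L r.curvature.F) x| *
          ‖F (fun i => a • siteToE (x i))‖ * (1 + ‖(fun i => a • siteToE (x i))‖) ^ (6 * n) :=
          le_mul_of_one_le_right h0 h1
      _ ≤ Kpt ^ n * a ^ (4 * n) * Ssum := h
      _ = Kpt ^ n * Ssum * a ^ (4 * n) := by ring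
  · -- compact support: a point carried beyond radius `K` kills `F`
    rintro x ⟨i, hi⟩
    have h1 : K < ‖(fun i => a • siteToE (x i)) i‖ := hi.trans_le (mul_norm_le_norm_smul_siteToE ha.le (x i))
    have h2 : F (fun i => a • siteToE (x i)) = 0 := by
      refine image_eq_zero_of_notMem_tsupport fun hmem => ?_
      have h := hFK hmem
      rw [mem_closedBall_zero_iff] at h
      linarith [norm_le_pi_norm (fun i => a • siteToE (x i)) i]
    change ‖F (fun i => a • siteToE (x i))‖ = 0
    rw [h2, norm_zero]

/-! ## §2 Along a leg scheme: the torus clause of `NearDiagonalVanishing` -/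

/-- ★ **Torus half of `NearDiagonalVanishing`.**  Under the binders of the crux (`MomentBounds6`, an admissible leg scheme, `n ≥ 2`,
`F ∈ ⁰𝒮` with compact support), for every `ε > 0` there is `δ > 0` such that eventually in `k` the near-diagonal part of the
TORUS centred moment sum is `≤ ε`:
`Σ_{x ∈ box(L_k)ⁿ, ∃ i ≠ j ∀ l, a_k|x_i^l − x_j^l| < δ} |∫ ∏ᵢ (dens_{xᵢ} − m_T(k)) dμ_{T_k}|·‖F(a_k x)‖ ≤ ε`.
Proof: §1 with `δ := min 1 (ε/(A+1))`, `A = K₀ⁿ S(F) n² (2K_F+1)^{4(n−1)}·81`, once `β_k ≥ β₄` and `a_k ≤ min ℓ₄ δ`. [folklore] -/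
theorem torus_nearDiagonal_eventually (r : LatticeRep G) (a : ℝ → ℝ) (hMB : MomentBounds6 G r a)
    (sch : SpeciesScheme (YMSpecies G)) (hsch : IsLegScheme a sch) {n : ℕ} (hn : 2 ≤ n)
    (F : 𝓢((Fin n → E4), ℂ)) (hF : IsOffDiagonal F) (hFc : HasCompactSupport (F : (Fin n → E4) → ℂ))
    {ε : ℝ} (hε : 0 < ε) :
    ∃ δ : ℝ, 0 < δ ∧ ∀ᶠ k in atTop,
      (∑ x ∈ Fintype.piFinset (fun _ : Fin n => box 4 (sch.L k)),
        (if (∃ i j : Fin n, i ≠ j ∧ ∀ l : Fin 4, sch.a k * |((x i l - x j l : ℤ) : ℝ)| < δ) then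
          |(∫ U, ∏ i, (r.curvature.F (configShift (-(x i)) (torusLift (2 * sch.L k + 1) U)) -
              wilsonTorusMean r.ρ (sch.β k) (sch.L k) r.curvature.F)
            ∂(wilsonMeasure (d := 4) (L := 2 * sch.L k + 1) r.ρ (sch.β k)))| *
            ‖F (fun i => (sch.a k) • siteToE (x i))‖ else 0)) ≤ ε := by
  classical
  obtain ⟨C, β₄, ℓ₄, hℓ, hC, H⟩ := abs_torusMoment_le_of_momentBounds r (momentBounds_of_momentBounds6 r a hMB)
  obtain ⟨C₀, hC₀⟩ := r.curvature.bounded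
  have hC₀0 : 0 ≤ C₀ := le_trans (abs_nonneg _) (hC₀ (fun _ => 1))
  obtain ⟨KF, hKF⟩ := (Metric.isBounded_iff_subset_closedBall (0 : Fin n → E4)).1 hFc.isCompact.isBounded
  set K : ℝ := max KF 0 with hKdef
  have hK : 0 ≤ K := le_max_right _ _
  have hFK : tsupport (F : (Fin n → E4) → ℂ) ⊆ Metric.closedBall 0 K :=
    hKF.trans (Metric.closedBall_subset_closedBall (le_max_left _ _))
  set Kpt : ℝ := (C₀ + C₀) * 2 ^ 4 * 3 ^ 6 + (C₀ + C₀) * 2 ^ 6 * 10 ^ 4 + 16 * C * 2 ^ 6 * (2 / ℓ₄ + 24) ^ 4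
    with hKpt
  set Ssum : ℝ := SchwartzMap.seminorm ℂ 0 (4 * n) F + SchwartzMap.seminorm ℂ (6 * n) (4 * n) F +
    SchwartzMap.seminorm ℂ 0 0 F + SchwartzMap.seminorm ℂ (6 * n) 0 F + SchwartzMap.seminorm ℂ (10 * n) 0 F
    with hSsum
  have hKpt0 : 0 ≤ Kpt := by rw [hKpt]; positivity
  have hSsum0 : 0 ≤ Ssum := by rw [hSsum]; positivity
  set A : ℝ := Kpt ^ n * Ssum * ((n : ℝ) ^ 2 * (2 * K + 1) ^ (4 * (n - 1)) * 3 ^ 4) with hA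
  have hA0 : 0 ≤ A := by rw [hA]; positivity
  set δ : ℝ := min 1 (ε / (A + 1)) with hδdef
  have hδ0 : 0 < δ := lt_min one_pos (div_pos hε (by linarith))
  have hδ1 : δ ≤ 1 := min_le_left _ _
  have hδε : A * δ ≤ ε := by
    have h1 : δ ≤ ε / (A + 1) := min_le_right _ _
    have h2 : A * δ ≤ A * (ε / (A + 1)) := mul_le_mul_of_nonneg_left h1 hA0
    have h3 : A * (ε / (A + 1)) ≤ ε := by
      rw [mul_div_assoc']
      rw [div_le_iff₀ (by linarith)]
      nlinarith
    exact h2.trans h3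
  refine ⟨δ, hδ0, ?_⟩
  obtain ⟨hak, hβ, hk⟩ := hsch
  have ev1 : ∀ᶠ k in atTop, β₄ ≤ sch.β k := hβ.eventually_ge_atTop β₄
  have ev2 : ∀ᶠ k in atTop, sch.a k < min ℓ₄ δ := sch.tendsto_a.eventually_lt_const (lt_min hℓ hδ0)
  filter_upwards [ev1, ev2] with k hβk hak2
  obtain ⟨-, hk24, hL14, hLa⟩ := hk k
  have hakpos : 0 < sch.a k := sch.a_pos k
  have hak1 : sch.a k ≤ 1 := hk24.trans (by norm_num)
  have hakℓ : sch.a k ≤ ℓ₄ := (hak2.le).trans (min_le_left _ _)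
  have hakδ : sch.a k ≤ δ := (hak2.le).trans (min_le_right _ _)
  -- the unpacked `MomentBounds` estimate at `β_k`, read at the spacing `a_k = a(β_k)`
  have Hk : ∀ (x : Fin n → Site 4) (R : ℕ), 1 ≤ R → (R : ℝ) * sch.a k ≤ ℓ₄ → 4 * R + 8 ≤ sch.L k →
      (∀ i j : Fin n, i ≠ j → ∃ k' : Fin 4,
        (2 * (R : ℤ) + 4) ≤ |((((x i k' - x j k' : ℤ) : ZMod (2 * sch.L k + 1))).valMinAbs : ℤ)|) →
      |torusMoment r.ρ (sch.β k) (sch.L k) r.curvature.F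
          (wilsonTorusMean r.ρ (sch.β k) (sch.L k) r.curvature.F) x| ≤ (C / (R : ℝ) ^ 4) ^ n := by
    intro x R hR hRa hRL hsep
    refine H (sch.β k) hβk (sch.L k) n x R hR ?_ hRL hsep
    rw [← hak k]; exact hRa
  have hmain := torus_near_sum_le r hℓ hC hC₀ Hk hakpos hak1 hakℓ hakδ hL14 hLa hn F hF hK hFK
  refine hmain.trans ?_
  have hδ4 : (3 * δ) ^ 4 = 3 ^ 4 * δ ^ 4 := by ring
  have hδpow : δ ^ 4 ≤ δ := by
    have := pow_le_pow_of_le_one hδ0.le hδ1 (show 1 ≤ 4 by norm_num)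
    rwa [pow_one] at this
  calc Kpt ^ n * Ssum * ((n : ℝ) ^ 2 * (2 * K + 1) ^ (4 * (n - 1)) * (3 * δ) ^ 4)
      = A * δ ^ 4 := by rw [hδ4, hA]; ring
    _ ≤ A * δ := mul_le_mul_of_nonneg_left hδpow hA0
    _ ≤ ε := hδε

/-! ## §3 Reduction of the crux to its cover half -/

/-- ★ **`NearDiagonalVanishing` from its cover half.**  The COVER clause of the crux — near-diagonal vanishing of the centred moment
sums on the checkerboard cells `C_k` (period lattice `(2L_k+1)·D₄`, transversal `⊇ box(L_k)`), read through `PeriodCell.lift` under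
`PeriodCell.measure`, with the same binders — implies `Theses.RecentredCoverTransfer.NearDiagonalVanishing` BY NAME: the torus
clause is `torus_nearDiagonal_eventually` (§2), and the two nearness scales combine as `δ := min δ_C δ_T` because the
near-diagonal indicator sums are monotone in `δ` (`NearDiagonal.ite_near_mono`).  The cover clause is what item
stmt-QuantumFields-23143 `CoverMomentBounds6` (cell-uniform single-scale ceilings on the D₄ cover) plus the `O(a⁴)` recentring
must deliver; it is OPEN and this theorem does not prove it. [folklore] -/
theorem nearDiagonalVanishing_of_coverHalf
    (hcov : open Literature.MathematicalPhysics.QuantumFieldTheory Literature.MathematicalPhysics.QuantumLattice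
        Literature.MathematicalPhysics.AQFT Literature.Probability.LatticeModels
        Summit.QuantumFields.YangMills.Cruxes.OSLegsFromFemtoAndGap.DlrCollarTransfer
        Summit.QuantumFields.YangMills.Cruxes.OSLegsAtWeakCouplingC.Sketch
        Summit.QuantumFields.YangMills.Cruxes.OSLegsAtWeakCouplingC.Y2Bridge Summit.QuantumFields.YangMills.Theorems.ROT
        Summit.QuantumFields.YangMills.Theorems.OSLegsFromFemtoAndGap in
      ∀ (G : Type) [Group G] [TopologicalSpace G] [IsTopologicalGroup G] [CompactSpace G], IsCompactSimpleLieGroup G →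
      letI : MeasurableSpace G := borel G; haveI : BorelSpace G := ⟨rfl⟩;
      ∀ (r : LatticeRep G) (a : ℝ → ℝ), (∀ β, 0 < a β) → Tendsto a atTop (nhds 0) → MomentBounds6 G r a →
      ∀ sch : SpeciesScheme (YMSpecies G), IsLegScheme a sch → ∀ C : ℕ → PeriodCell 4,
      (∀ k, ((C k).P : Set (Fin 4 → ℤ)) = {z | ∃ w : Fin 4 → ℤ, Even (∑ i, w i) ∧ z = ((2 * sch.L k + 1 : ℕ) : ℤ) • w} ∧
        box 4 (sch.L k) ⊆ (C k).reps) →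
      ∀ (n : ℕ), 2 ≤ n → ∀ F : SchwartzMap (Fin n → EuclideanSpace ℝ (Fin 4)) ℂ, IsOffDiagonal F →
      HasCompactSupport (F : (Fin n → EuclideanSpace ℝ (Fin 4)) → ℂ) → ∀ ε : ℝ, 0 < ε → ∃ δ : ℝ, 0 < δ ∧ ∀ᶠ k in atTop,
      (∑ x ∈ Fintype.piFinset (fun _ : Fin n => box 4 (sch.L k)),
        (if (∃ i j : Fin n, i ≠ j ∧ ∀ l : Fin 4, sch.a k * |((x i l - x j l : ℤ) : ℝ)| < δ) then
          |(∫ U, ∏ i, (r.curvature.F (configShift (-(x i)) ((C k).lift U)) -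
              wilsonTorusMean r.ρ (sch.β k) (sch.L k) r.curvature.F) ∂((C k).measure r.ρ (sch.β k)))| *
            ‖F (fun i => (sch.a k) • siteToE (x i))‖ else 0)) ≤ ε) :
    Summit.QuantumFields.YangMills.Theses.RecentredCoverTransfer.NearDiagonalVanishing := by
  intro G _ _ _ _ hG
  letI : MeasurableSpace G := borel G
  haveI : BorelSpace G := ⟨rfl⟩
  intro r a ha ha0 hMB sch hsch C hC n hn F hF hFc ε hε
  obtain ⟨δC, hδC, hevC⟩ := hcov G hG r a ha ha0 hMB sch hsch C hC n hn F hF hFc ε hε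
  obtain ⟨δT, hδT, hevT⟩ := torus_nearDiagonal_eventually r a hMB sch hsch hn F hF hFc hε
  refine ⟨min δC δT, lt_min hδC hδT, ?_⟩
  filter_upwards [hevC, hevT] with k hCk hTk
  refine ⟨le_trans (Finset.sum_le_sum fun x _ => ?_) hCk, le_trans (Finset.sum_le_sum fun x _ => ?_) hTk⟩
  · exact ite_near_mono (min_le_left _ _) x (mul_nonneg (abs_nonneg _) (norm_nonneg _))
  · exact ite_near_mono (min_le_right _ _) x (mul_nonneg (abs_nonneg _) (norm_nonneg _))

end Summit.QuantumFields.YangMills.Theorems.RecentredCoverTransfer.NearDiagonal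

end
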